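import Mathlib.Algebra.Algebra.Bilinear
import Mathlib.RingTheory.Ideal.Colon
import Literature.RingTheory.MvPolynomial.HomogeneousHilbertFunction
import Literature.AlgebraicGeometry.Kloosterman2025.PencilOfPairingsKernelBounds
import HarnessLib

/-!
# The graded Artinian Gorenstein algebra of a linear functional (Kloosterman 2025, Lemma 2.1, Notation 2.4, Lemmas 2.9 and 2.10)

R. Kloosterman, *On a conjecture on Hodge loci of linear combinations of linear subvarieties*,
Rend. Circ. Mat. Palermo (2) 74 (2025), doi:10.1007/s12215-025-01307-4 = arXiv:2312.12363, §2.1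
'Artinian Gorenstein algebras' and §2.3 'Bilinear maps' (text read: arXiv v2, pp. 5–7).

**Lemma 2.1 (verbatim).** "Let `t` be a positive integer. Let `W ⊂ S_t` be a linear subspace. Let
`I ⊂ S` be the largest ideal such that `I_t = W_t`. Suppose `W` is base point free. Then there exists a
`codim_{S_t} W − 1` family of graded Artinian Gorenstein algebras of socle degree `t`, each of which is
a quotient of `S/I`. Moreover, if `codim_{S_t} W = 1` then `S/I` is a graded Artinian Gorenstein algebra
with socle degree `t`." Printed proof of the 'Moreover' part: "if there would be a nonnegative integer
`e ≤ t−1` and an `f ∈ (S/I)_e` nonzero such that `f (S/I)_{t−e}` is zero in `(S/I)_t` then for any lift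
`f̃ ∈ S_e` of `f` the ideal `I'` generated by `I` and `f` would be strictly larger than `I` and
`I_t = I'_t`, contradicting that `I` is the largest such ideal. Hence the multiplication map yields a
perfect pairing."

This is the construction by which the paper attaches an Artinian Gorenstein ideal to a Hodge class
([cite: Kloosterman2025, Construction 3.1, Remark 3.2]: `W` = the lift to `S_{(d−2)(k+1)}` of
`f_γ^⊥ ⊂ (S/J)_{(d−2)(k+1)}`, `I(γ)` = the largest ideal with `I_{(k+1)(d−2)} = W`), i.e. Macaulay's
inverse-system description of graded Artinian Gorenstein quotients of `S` by the annihilator of ONE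
linear functional on `S_t` (a codimension-one `W ⊂ S_t` is the kernel of a functional `ℓ : S_t → K`,
unique up to a scalar).

**What this file proves** (over any field `K`, `S = K[x_σ]`; for the dimension statements `σ` finite).
For a `K`-linear functional `ℓ : S → K` CONCENTRATED IN DEGREE `t` (`ℓ(p) = ℓ(p_t)`, i.e. `ℓ` factors
through the projection to `S_t`; such an `ℓ` is the same as a functional on `S_t`):

* `annIdeal ℓ = {g ∈ S | ℓ(g·h) = 0 for all h}` is an ideal, the LARGEST ideal on which `ℓ` vanishes
  (`le_annIdeal_of_forall_apply_eq_zero`), homogeneous (`isHomogeneous_annIdeal`), with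
  `(annIdeal ℓ)_t = ker(ℓ|_{S_t})` (`mem_annIdeal_iff_apply_eq_zero`) and `(annIdeal ℓ)_e = S_e` for
  `e > t` (`idealDegree_annIdeal_eq_of_lt`) — so for `W = ker(ℓ|_{S_t})` of codimension one,
  `annIdeal ℓ` IS the printed "largest ideal `I` with `I_t = W`" among homogeneous ideals
  (`le_annIdeal_of_isHomogeneous`; all ideals of the paper are graded) and `(S/I)_{>t} = 0` (in this
  functional form no base-point-freeness is needed for the vanishing above `t`);
* THE PERFECT PAIRING (the content of Lemma 2.1): for `a + b = t` the multiplication pairing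
  `S_a × S_b → K`, `(g,h) ↦ ℓ(gh)` (`gradedMulForm ℓ a b`) has left kernel exactly `(annIdeal ℓ)_a`
  and right kernel exactly `(annIdeal ℓ)_b` (`ker_gradedMulForm`, `ker_gradedMulForm_flip`), i.e. it
  descends to a perfect pairing `(S/I)_a × (S/I)_b → (S/I)_t ≅ K`; consequently GORENSTEIN SYMMETRY of
  the Hilbert function `h_I(a) = h_I(b)` (`hilbert_annIdeal_symm`, with `h_I(e) = dim S_e − dim I_e` written
  on the tree's `idealDegree I e = I ∩ S_e` exactly as in `HomogeneousHilbertFunction.lean`), `h_I(t) = 1`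
  for `ℓ ≠ 0` (`hilbert_annIdeal_top`), `h_I(e) = 0` for `e > t`, and "rank of the pairing `= h_I(a)`"
  (`finrank_range_gradedMulForm`);
* the setting of [cite: Kloosterman2025, Notation 2.4 / Lemma 2.9] made concrete: for two such
  functionals `ℓ₁, ℓ₂` (same `t`) and `I_j = annIdeal ℓ_j`, the pairings
  `φ_j : S_α × S_{t−α} → (S/I_j)_t ≅ K` are `gradedMulForm ℓ_j α (t−α)`; the two sentences of the printed
  proof of Lemma 2.9 "The left kernel of `φ_j` equals `(I_j/I₁∩I₂)_α`. Hence the rank of `φ_j` equals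
  `h_{I_j}(α)`, which equals `h_{I_j}(t−α)` by Gorenstein duality." are `ker_gradedMulForm` +
  `finrank_range_gradedMulForm` + `hilbert_annIdeal_symm`, and the S-level form of **Lemma 2.9** itself —
  if `(I₁+I₂)_{t−α} = S_{t−α}` (`h_{I₁+I₂}(t−α) = 0`) then for every `c ≠ 0` the left kernel of
  `φ₁ + c·φ₂` on `S_α` is exactly `(I₁ ∩ I₂)_α`, i.e. ZERO on `(S/I₁∩I₂)_α` — is
  `ker_gradedMulForm_add_smul` (a direct proof; the abstract mechanism is the tree's
  `leftKernel_add_smul_eq_bot`, file `PencilOfPairingsLeftKernel.lean`);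
* colon ideals: for `P ∈ S` the functional `ℓ_P = ℓ(· P)` has `annIdeal ℓ_P = (annIdeal ℓ : P)`
  (`annIdeal_comp_mulRight`), and `ℓ_P` is concentrated in degree `t − e` when `P` is a form of degree
  `e ≤ t` (`comp_mulRight_homogeneousComponent`) — the algebra behind "the Artinian Gorenstein ideal
  `(J^F : P_δ)` of a cycle" once `J^F` itself is of the form `annIdeal` (for the Fermat polynomial `J^F` is
  the annihilator ideal of the coefficient functional of `∏ xᵢ^{d−2}` — Macaulay's theorem in that case —
  which is proved in a companion file of this seat); Gorenstein symmetry, socle degree `t − e` and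
  vanishing above it for `(I(ℓ) : P)`: `hilbert_colon_symm`, `hilbert_colon_top`, `idealDegree_colon_eq_of_lt`.

* **Lemma 2.10** (left kernels of `μ_α : ((J+I)/I)_α × ((J+I)/I)_{t−α} → (S/I)_t` propagate from degree
  `α < t` to `α + 1`), S-level with `I = I(ℓ)`: `exists_mem_leftKernel_succ`, via "the socle of `S/I(ℓ)` sits
  in degree `t`" (`mem_annIdeal_of_forall_X_mul_mem`).

* the EXCESS BOUND of the printed proof of Lemma 2.9 + Lemma 3.12 with all kernels identified:
  `dim ker_L(φ₁ + cφ₂)|_{S_a} − dim (I₁∩I₂)_a ≤ h_{I₁+I₂}(b)` for `a + b = t`, `c ≠ 0`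
  (`finrank_ker_gradedMulForm_add_smul_add_le`, `excess_le_hilbert_sup`) — the census dictionary
  "`e(λ) ≤ H = h_{I_Z+I_W}(kd−2k−2)`" for Gorenstein ideals of functionals.

NOT formalised here: the `codim W − 1` family of the first sentence of Lemma 2.1 (each codimension-one
`W' ⊃ W` of `S_t` gives one functional), base-point-freeness / [GreenF], Krull dimension, and the words
'Artinian Gorenstein' as a ring-theoretic predicate (Mathlib has no Gorenstein rings); what is proved is
exactly the perfect-pairing property that the printed proof establishes and that §2.3 uses.
-/

noncomputable section

open MvPolynomial Module Literature.RingTheory.MvPolynomial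

attribute [local instance] MvPolynomial.gradedAlgebra

namespace Literature.AlgebraicGeometry.Kloosterman2025

/-! ## The annihilator ideal of a functional on a commutative algebra -/

section General

variable {K : Type*} [Field K] {A : Type*} [CommRing A] [Algebra K A]

/-- The **annihilator ideal** `I(ℓ) = {g | ℓ(g·h) = 0 ∀ h}` of a linear functional `ℓ : A → K` on a
commutative `K`-algebra: the largest ideal contained in `ker ℓ` (Macaulay's inverse system of `ℓ`;
[cite: Kloosterman2025, Lemma 2.1]: "the largest ideal such that `I_t = W`", `W = ker ℓ|_{S_t}`). -/
def annIdeal (ℓ : A →ₗ[K] K) : Ideal A where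
  carrier := {g | ∀ h, ℓ (g * h) = 0}
  add_mem' := by
    intro g₁ g₂ h₁ h₂
    simp only [Set.mem_setOf_eq] at h₁ h₂ ⊢
    intro h
    rw [add_mul, map_add, h₁ h, h₂ h, add_zero]
  zero_mem' := by
    simp only [Set.mem_setOf_eq]
    intro h
    rw [zero_mul, map_zero]
  smul_mem' := by
    intro c g hg
    simp only [smul_eq_mul, Set.mem_setOf_eq] at hg ⊢
    intro h
    rw [mul_comm c g, mul_assoc]
    exact hg (c * h)

/-- Membership in `I(ℓ)`. [cite: Kloosterman2025, Lemma 2.1] -/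
theorem mem_annIdeal_iff {ℓ : A →ₗ[K] K} {g : A} : g ∈ annIdeal ℓ ↔ ∀ h, ℓ (g * h) = 0 := Iff.rfl

/-- `ℓ` vanishes on `I(ℓ)` (take `h = 1`). [cite: Kloosterman2025, Lemma 2.1] -/
theorem apply_eq_zero_of_mem_annIdeal {ℓ : A →ₗ[K] K} {g : A} (hg : g ∈ annIdeal ℓ) : ℓ g = 0 := by
  simpa using hg 1

/-- **`I(ℓ)` is the largest ideal on which `ℓ` vanishes** ("the largest ideal such that `I_t = W`").
[cite: Kloosterman2025, Lemma 2.1] -/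
theorem le_annIdeal_of_forall_apply_eq_zero {ℓ : A →ₗ[K] K} {J : Ideal A} (hJ : ∀ g ∈ J, ℓ g = 0) :
    J ≤ annIdeal ℓ :=
  fun _ hg h => hJ _ (J.mul_mem_right h hg)

/-- `I(ℓ) = A` iff `ℓ = 0` (so the quotient has socle degree `t` exactly when `ℓ ≠ 0`).
[cite: Kloosterman2025, Lemma 2.1 (proof)] -/
theorem annIdeal_eq_top_iff {ℓ : A →ₗ[K] K} : annIdeal ℓ = ⊤ ↔ ℓ = 0 := by
  constructor
  · intro h
    ext g
    have hg : g ∈ annIdeal ℓ := h ▸ Submodule.mem_top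
    simpa using apply_eq_zero_of_mem_annIdeal hg
  · intro h
    exact eq_top_iff.mpr fun g _ h' => by simp [h]

/-- The multiplication pairing `(g, h) ↦ ℓ(g h)` of the functional `ℓ`, as a curried bilinear map
(the pairing "`S/I_e × S/I_{t−e} → (S/I)_t → ℂ`" of [cite: Kloosterman2025, Lemma 2.1, Notation 2.4] before
grading and before passing to the quotient). -/
def mulForm (ℓ : A →ₗ[K] K) : A →ₗ[K] A →ₗ[K] K :=
  (LinearMap.mul K A).compr₂ ℓ

/-- `mulForm ℓ g h = ℓ (g h)`. [cite: Kloosterman2025, Notation 2.4] -/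
@[simp] theorem mulForm_apply (ℓ : A →ₗ[K] K) (g h : A) : mulForm ℓ g h = ℓ (g * h) := by
  simp [mulForm]

/-- The pairing is symmetric (commutativity of `S`: "the multiplication map"). [cite: Kloosterman2025, Lemma 2.1 (proof)] -/
theorem mulForm_flip (ℓ : A →ₗ[K] K) : (mulForm ℓ).flip = mulForm ℓ := by
  ext g h
  simp [mul_comm]

/-- **The left kernel of `(g,h) ↦ ℓ(gh)` on `A` is `I(ℓ)`.** [cite: Kloosterman2025, Lemma 2.1] -/
theorem ker_mulForm (ℓ : A →ₗ[K] K) : LinearMap.ker (mulForm ℓ) = (annIdeal ℓ).restrictScalars K := by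
  ext g
  rw [mem_ker_iff_forall]
  simp [mem_annIdeal_iff]

/-- … and so is the right kernel. [cite: Kloosterman2025, Lemma 2.1] -/
theorem ker_mulForm_flip (ℓ : A →ₗ[K] K) :
    LinearMap.ker (mulForm ℓ).flip = (annIdeal ℓ).restrictScalars K := by
  rw [mulForm_flip, ker_mulForm]

/-- **Colon ideals.** For `P ∈ A` the functional `ℓ_P = ℓ(· P)` has annihilator ideal
`I(ℓ_P) = (I(ℓ) : P) = {g | g P ∈ I(ℓ)}` — the algebra behind "the Artinian Gorenstein ideal `(J : P)` of a
cycle" when `J = I(ℓ)`. [folklore; cf. [cite: Kloosterman2025, Construction 3.1]] -/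
theorem annIdeal_comp_mulRight (ℓ : A →ₗ[K] K) (P : A) :
    annIdeal (ℓ ∘ₗ LinearMap.mulRight K P) = (annIdeal ℓ).colon {P} := by
  ext g
  simp only [mem_annIdeal_iff, LinearMap.coe_comp, Function.comp_apply, LinearMap.mulRight_apply,
    Submodule.mem_colon_singleton, smul_eq_mul]
  constructor
  · intro hg h
    have := hg h
    rwa [mul_right_comm] at this
  · intro hg h
    have := hg h
    rwa [mul_right_comm]

/-- Pointwise form of `annIdeal_comp_mulRight`: `g ∈ I(ℓ_P) ↔ g P ∈ I(ℓ)`. [folklore; cf. [cite: Kloosterman2025, Construction 3.1]] -/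
theorem mem_annIdeal_comp_mulRight_iff (ℓ : A →ₗ[K] K) (P g : A) :
    g ∈ annIdeal (ℓ ∘ₗ LinearMap.mulRight K P) ↔ g * P ∈ annIdeal ℓ := by
  rw [annIdeal_comp_mulRight, Submodule.mem_colon_singleton, smul_eq_mul]

/-- `I(ℓ) ≤ I(ℓ_P)`. [folklore; cf. [cite: Kloosterman2025, Construction 3.1]] -/
theorem annIdeal_le_annIdeal_comp_mulRight (ℓ : A →ₗ[K] K) (P : A) :
    annIdeal ℓ ≤ annIdeal (ℓ ∘ₗ LinearMap.mulRight K P) := by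
  intro g hg
  rw [mem_annIdeal_comp_mulRight_iff]
  exact (annIdeal ℓ).mul_mem_right P hg

/-- `I(ℓ_P) = A` iff `P ∈ I(ℓ)`. [folklore; cf. [cite: Kloosterman2025, Construction 3.1]] -/
theorem annIdeal_comp_mulRight_eq_top_iff (ℓ : A →ₗ[K] K) (P : A) :
    annIdeal (ℓ ∘ₗ LinearMap.mulRight K P) = ⊤ ↔ P ∈ annIdeal ℓ := by
  rw [Ideal.eq_top_iff_one, mem_annIdeal_comp_mulRight_iff, one_mul]

end General

/-! ## Functionals on `K[x_σ]` concentrated in one degree: the graded Artinian Gorenstein quotient -/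

section Graded

variable {K : Type*} [Field K] {σ : Type*} {t : ℕ} {ℓ : MvPolynomial σ K →ₗ[K] K}

/-- A functional concentrated in degree `t` (the printed `σ_j : (S/I_j)_t → ℂ` composed with the projection to
degree `t`) kills forms of every other degree. [cite: Kloosterman2025, Lemma 2.1 (proof)] -/
theorem apply_eq_zero_of_isHomogeneous_ne (hℓ : ∀ p, ℓ (homogeneousComponent t p) = ℓ p)
    {p : MvPolynomial σ K} {j : ℕ} (hp : p.IsHomogeneous j) (hj : j ≠ t) : ℓ p = 0 := by
  rw [← hℓ p, homogeneousComponent_of_mem hp, if_neg (Ne.symm hj), map_zero]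

/-- For a form `g` of degree `a` and `a + b = t`: `ℓ(g h) = ℓ(g h_b)` — only the degree-`b` component of
`h` is seen. [cite: Kloosterman2025, Lemma 2.1 (proof)] -/
theorem apply_mul_eq_apply_mul_homogeneousComponent (hℓ : ∀ p, ℓ (homogeneousComponent t p) = ℓ p)
    {g : MvPolynomial σ K} {a b : ℕ} (hg : g.IsHomogeneous a) (hab : a + b = t)
    (h : MvPolynomial σ K) : ℓ (g * h) = ℓ (g * homogeneousComponent b h) := by
  rw [← hℓ (g * h), ← hab, add_comm, homogeneousComponent_mul_add_of_isHomogeneous hg h b]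

/-- For a form `g` of degree `a > t`: `ℓ(g h) = 0` for all `h` ("`deg(ℓ f) = t + 1`", printed proof of Lemma 2.10;
the vanishing of `(S/I)_{t+1}`). [cite: Kloosterman2025, Lemma 2.1 (proof)] -/
theorem apply_mul_eq_zero_of_lt (hℓ : ∀ p, ℓ (homogeneousComponent t p) = ℓ p)
    {g : MvPolynomial σ K} {a : ℕ} (hg : g.IsHomogeneous a) (ha : t < a) (h : MvPolynomial σ K) :
    ℓ (g * h) = 0 := by
  classical
  have hsum : ℓ (g * h) = ∑ j ∈ Finset.range (h.totalDegree + 1), ℓ (g * homogeneousComponent j h) := by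
    conv_lhs => rw [← sum_homogeneousComponent h, Finset.mul_sum, map_sum]
  rw [hsum]
  refine Finset.sum_eq_zero fun j _ => ?_
  exact apply_eq_zero_of_isHomogeneous_ne hℓ (hg.mul (homogeneousComponent_isHomogeneous j h))
    (by omega)

/-- **`(S/I(ℓ))_e = 0` for `e > t`**: every form of degree `> t` lies in `I(ℓ)`.
[cite: Kloosterman2025, Lemma 2.1] -/
theorem mem_annIdeal_of_isHomogeneous_of_lt (hℓ : ∀ p, ℓ (homogeneousComponent t p) = ℓ p)
    {g : MvPolynomial σ K} {a : ℕ} (hg : g.IsHomogeneous a) (ha : t < a) : g ∈ annIdeal ℓ :=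
  fun h => apply_mul_eq_zero_of_lt hℓ hg ha h

/-- Degreewise form: `I(ℓ)_e = S_e` for `e > t`. [cite: Kloosterman2025, Lemma 2.1] -/
theorem idealDegree_annIdeal_eq_of_lt (hℓ : ∀ p, ℓ (homogeneousComponent t p) = ℓ p) {e : ℕ}
    (he : t < e) : idealDegree (annIdeal ℓ) e = homogeneousSubmodule σ K e := by
  refine le_antisymm (idealDegree_le_homogeneousSubmodule _ _) fun g hg => ?_
  exact ⟨mem_annIdeal_of_isHomogeneous_of_lt hℓ hg he, hg⟩

/-- **The perfect pairing in complementary degrees** (the content of the 'Moreover' part of Lemma 2.1):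
if `a + b = t` and a form `g` of degree `a` pairs to zero with every form of degree `b`, then
`g ∈ I(ℓ)` (it pairs to zero with everything). [cite: Kloosterman2025, Lemma 2.1] -/
theorem mem_annIdeal_of_forall_isHomogeneous (hℓ : ∀ p, ℓ (homogeneousComponent t p) = ℓ p)
    {g : MvPolynomial σ K} {a b : ℕ} (hg : g.IsHomogeneous a) (hab : a + b = t)
    (H : ∀ h : MvPolynomial σ K, h.IsHomogeneous b → ℓ (g * h) = 0) : g ∈ annIdeal ℓ := by
  intro h
  rw [apply_mul_eq_apply_mul_homogeneousComponent hℓ hg hab h]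
  exact H _ (homogeneousComponent_isHomogeneous b h)

/-- In the top degree: a form `g` of degree `t` lies in `I(ℓ)` iff `ℓ(g) = 0`; so
`I(ℓ)_t = ker(ℓ|_{S_t}) = W`. [cite: Kloosterman2025, Lemma 2.1] -/
theorem mem_annIdeal_iff_apply_eq_zero (hℓ : ∀ p, ℓ (homogeneousComponent t p) = ℓ p)
    {g : MvPolynomial σ K} (hg : g.IsHomogeneous t) : g ∈ annIdeal ℓ ↔ ℓ g = 0 := by
  refine ⟨apply_eq_zero_of_mem_annIdeal, fun h0 => ?_⟩
  refine mem_annIdeal_of_forall_isHomogeneous hℓ hg (add_zero t) fun h hh => ?_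
  rw [← totalDegree_zero_iff_isHomogeneous, totalDegree_eq_zero_iff_eq_C] at hh
  rw [hh, mul_comm, ← smul_eq_C_mul, map_smul, h0, smul_zero]

/-- **`I(ℓ)` is a homogeneous ideal.** [cite: Kloosterman2025, Lemma 2.1] -/
theorem homogeneousComponent_mem_annIdeal (hℓ : ∀ p, ℓ (homogeneousComponent t p) = ℓ p)
    {g : MvPolynomial σ K} (hg : g ∈ annIdeal ℓ) (i : ℕ) :
    homogeneousComponent i g ∈ annIdeal ℓ := by
  classical
  by_cases hi : t < i
  · exact mem_annIdeal_of_isHomogeneous_of_lt hℓ (homogeneousComponent_isHomogeneous i g) hi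
  · have hit : i + (t - i) = t := by omega
    refine mem_annIdeal_of_forall_isHomogeneous hℓ (homogeneousComponent_isHomogeneous i g) hit
      fun h hh => ?_
    -- `ℓ(g_i h) = ℓ((g h)_t)`-type bookkeeping: `ℓ(g h) = Σ_j ℓ(g_j h)` and only `j = i` survives
    have hsum : ℓ (g * h) = ∑ j ∈ Finset.range (g.totalDegree + 1), ℓ (homogeneousComponent j g * h) := by
      conv_lhs => rw [← sum_homogeneousComponent g, Finset.sum_mul, map_sum]
    have hvan : ∀ j, j ≠ i → ℓ (homogeneousComponent j g * h) = 0 := fun j hj =>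
      apply_eq_zero_of_isHomogeneous_ne hℓ ((homogeneousComponent_isHomogeneous j g).mul hh) (by omega)
    have hgh : ℓ (g * h) = 0 := hg h
    by_cases hmem : i ∈ Finset.range (g.totalDegree + 1)
    · rw [Finset.sum_eq_single i (fun j _ hj => hvan j hj) (fun h' => absurd hmem h')] at hsum
      rw [← hsum, hgh]
    · rw [homogeneousComponent_eq_zero _ _ (by rw [Finset.mem_range] at hmem; omega), zero_mul, map_zero]

/-- `I(ℓ)` is homogeneous, in Mathlib's sense. [cite: Kloosterman2025, Lemma 2.1] -/
theorem isHomogeneous_annIdeal (hℓ : ∀ p, ℓ (homogeneousComponent t p) = ℓ p) :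
    (annIdeal ℓ).IsHomogeneous (homogeneousSubmodule σ K) := by
  intro i g hg
  rw [← DirectSum.Decomposition.decompose'_eq, decomposition.decompose'_apply]
  exact homogeneousComponent_mem_annIdeal hℓ hg i

/-- **`I(ℓ)` is the largest homogeneous ideal `J` with `J_t ⊆ W = ker(ℓ|_{S_t})`** — the printed "largest
ideal such that `I_t = W`" (all ideals of the paper are graded; for a homogeneous `J`, `ℓ` vanishes on `J` as
soon as it vanishes on `J_t`, because `ℓ(g) = ℓ(g_t)`). [cite: Kloosterman2025, Lemma 2.1] -/
theorem le_annIdeal_of_isHomogeneous (hℓ : ∀ p, ℓ (homogeneousComponent t p) = ℓ p)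
    {J : Ideal (MvPolynomial σ K)} (hJ : J.IsHomogeneous (homogeneousSubmodule σ K))
    (hJt : ∀ g ∈ J, g.IsHomogeneous t → ℓ g = 0) : J ≤ annIdeal ℓ :=
  le_annIdeal_of_forall_apply_eq_zero fun g hg => by
    rw [← hℓ g]
    exact hJt _ (homogeneousComponent_mem_of_mem hJ hg t) (homogeneousComponent_isHomogeneous t g)

/-! ### The graded pieces of the pairing -/

/-- The degree-`(a,b)` piece `S_a × S_b → K`, `(g,h) ↦ ℓ(gh)` of the multiplication pairing — for
`a + b = t` this is the printed `(S/I)_a × (S/I)_{t−a} → (S/I)_t ≅ K` before passing to the quotient, and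
for two functionals the pairings `φ_j` of Notation 2.4. [cite: Kloosterman2025, Lemma 2.1, Notation 2.4] -/
def gradedMulForm (ℓ : MvPolynomial σ K →ₗ[K] K) (a b : ℕ) :
    homogeneousSubmodule σ K a →ₗ[K] homogeneousSubmodule σ K b →ₗ[K] K :=
  (mulForm ℓ).domRestrict₁₂ (homogeneousSubmodule σ K a) (homogeneousSubmodule σ K b)

/-- `gradedMulForm ℓ a b g h = ℓ (g h)`. [cite: Kloosterman2025, Notation 2.4] -/
@[simp] theorem gradedMulForm_apply (ℓ : MvPolynomial σ K →ₗ[K] K) (a b : ℕ)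
    (g : homogeneousSubmodule σ K a) (h : homogeneousSubmodule σ K b) :
    gradedMulForm ℓ a b g h = ℓ ((g : MvPolynomial σ K) * h) := by
  simp [gradedMulForm, LinearMap.domRestrict₁₂_apply]

/-- Symmetry: the flip of the `(a,b)` piece is the `(b,a)` piece. [cite: Kloosterman2025, Notation 2.4] -/
theorem gradedMulForm_flip (ℓ : MvPolynomial σ K →ₗ[K] K) (a b : ℕ) :
    (gradedMulForm ℓ a b).flip = gradedMulForm ℓ b a := by
  ext h g
  simp [mul_comm]

/-- **Left kernel of the `(a,b)` piece `= I(ℓ)_a`** for `a + b = t` ("The left kernel of `φ_j` equals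
`(I_j/I₁∩I₂)_α`", printed proof of Lemma 2.9; the perfect pairing of Lemma 2.1).
[cite: Kloosterman2025, Lemma 2.1, Lemma 2.9 (proof)] -/
theorem ker_gradedMulForm (hℓ : ∀ p, ℓ (homogeneousComponent t p) = ℓ p) {a b : ℕ} (hab : a + b = t) :
    LinearMap.ker (gradedMulForm ℓ a b) =
      (idealDegree (annIdeal ℓ) a).comap (homogeneousSubmodule σ K a).subtype := by
  ext g
  rw [mem_ker_iff_forall, Submodule.mem_comap, Submodule.subtype_apply, mem_idealDegree]
  constructor
  · intro H
    refine ⟨mem_annIdeal_of_forall_isHomogeneous hℓ g.2 hab fun h hh => ?_, g.2⟩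
    simpa using H ⟨h, hh⟩
  · rintro ⟨hg, -⟩ h
    simpa using hg (h : MvPolynomial σ K)

/-- **Right kernel of the `(a,b)` piece `= I(ℓ)_b`** for `a + b = t`. [cite: Kloosterman2025, Lemma 2.1] -/
theorem ker_gradedMulForm_flip (hℓ : ∀ p, ℓ (homogeneousComponent t p) = ℓ p) {a b : ℕ}
    (hab : a + b = t) :
    LinearMap.ker (gradedMulForm ℓ a b).flip =
      (idealDegree (annIdeal ℓ) b).comap (homogeneousSubmodule σ K b).subtype := by
  rw [gradedMulForm_flip, ker_gradedMulForm hℓ (by omega)]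

/-- `dim ker = dim I(ℓ)_a`. [cite: Kloosterman2025, Lemma 2.9 (proof)] -/
theorem finrank_ker_gradedMulForm (hℓ : ∀ p, ℓ (homogeneousComponent t p) = ℓ p) {a b : ℕ}
    (hab : a + b = t) :
    finrank K (LinearMap.ker (gradedMulForm ℓ a b)) = finrank K (idealDegree (annIdeal ℓ) a) := by
  rw [ker_gradedMulForm hℓ hab]
  exact (Submodule.comapSubtypeEquivOfLe (idealDegree_le_homogeneousSubmodule _ _)).finrank_eq

/-- `dim ker(flip) = dim I(ℓ)_b`. [cite: Kloosterman2025, Lemma 2.9 (proof)] -/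
theorem finrank_ker_gradedMulForm_flip (hℓ : ∀ p, ℓ (homogeneousComponent t p) = ℓ p) {a b : ℕ}
    (hab : a + b = t) :
    finrank K (LinearMap.ker (gradedMulForm ℓ a b).flip) = finrank K (idealDegree (annIdeal ℓ) b) := by
  rw [ker_gradedMulForm_flip hℓ hab]
  exact (Submodule.comapSubtypeEquivOfLe (idealDegree_le_homogeneousSubmodule _ _)).finrank_eq

/-- **Gorenstein symmetry, additive form**: `dim S_a + dim I_b = dim S_b + dim I_a` for `a + b = t`,
`I = I(ℓ)` (both sides equal `dim I_a + dim I_b + rank`). [cite: Kloosterman2025, Lemma 2.1, Lemma 2.9 (proof)] -/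
theorem finrank_add_finrank_idealDegree_annIdeal_eq [Finite σ]
    (hℓ : ∀ p, ℓ (homogeneousComponent t p) = ℓ p) {a b : ℕ} (hab : a + b = t) :
    finrank K (homogeneousSubmodule σ K a) + finrank K (idealDegree (annIdeal ℓ) b) =
      finrank K (homogeneousSubmodule σ K b) + finrank K (idealDegree (annIdeal ℓ) a) := by
  haveI := finite_homogeneousSubmodule (K := K) (σ := σ) a
  haveI := finite_homogeneousSubmodule (K := K) (σ := σ) b
  have h1 := LinearMap.finrank_range_add_finrank_ker (gradedMulForm ℓ a b)
  have h2 := finrank_ker_flip_add_finrank_range (gradedMulForm ℓ a b)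
  rw [finrank_ker_gradedMulForm hℓ hab] at h1
  rw [finrank_ker_gradedMulForm_flip hℓ hab] at h2
  omega

/-- **"The rank of `φ_j` equals `h_{I_j}(α)`"**: `rank = dim S_a − dim I(ℓ)_a` for `a + b = t`.
[cite: Kloosterman2025, Lemma 2.9 (proof)] -/
theorem finrank_range_gradedMulForm [Finite σ] (hℓ : ∀ p, ℓ (homogeneousComponent t p) = ℓ p)
    {a b : ℕ} (hab : a + b = t) :
    finrank K (LinearMap.range (gradedMulForm ℓ a b)) =
      finrank K (homogeneousSubmodule σ K a) - finrank K (idealDegree (annIdeal ℓ) a) := by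
  haveI := finite_homogeneousSubmodule (K := K) (σ := σ) a
  have h1 := LinearMap.finrank_range_add_finrank_ker (gradedMulForm ℓ a b)
  rw [finrank_ker_gradedMulForm hℓ hab] at h1
  omega

/-- **Gorenstein symmetry of the Hilbert function**: `h_I(a) = h_I(b)` for `a + b = t`, `I = I(ℓ)`
("which equals `h_{I_j}(t−α)` by Gorenstein duality"). [cite: Kloosterman2025, Lemma 2.1, Lemma 2.9 (proof)] -/
theorem hilbert_annIdeal_symm [Finite σ] (hℓ : ∀ p, ℓ (homogeneousComponent t p) = ℓ p) {a b : ℕ}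
    (hab : a + b = t) :
    finrank K (homogeneousSubmodule σ K a) - finrank K (idealDegree (annIdeal ℓ) a) =
      finrank K (homogeneousSubmodule σ K b) - finrank K (idealDegree (annIdeal ℓ) b) := by
  have h := finrank_add_finrank_idealDegree_annIdeal_eq hℓ hab
  have h1 := finrank_idealDegree_le (annIdeal ℓ) a
  have h2 := finrank_idealDegree_le (annIdeal ℓ) b
  omega

/-- `h_I(e) = 0` for `e > t`. [cite: Kloosterman2025, Lemma 2.1] -/
theorem hilbert_annIdeal_eq_zero_of_lt [Finite σ] (hℓ : ∀ p, ℓ (homogeneousComponent t p) = ℓ p)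
    {e : ℕ} (he : t < e) :
    finrank K (homogeneousSubmodule σ K e) - finrank K (idealDegree (annIdeal ℓ) e) = 0 := by
  rw [idealDegree_annIdeal_eq_of_lt hℓ he, Nat.sub_self]

/-- **Socle degree `t`: `h_I(t) = 1`** when `ℓ ≠ 0` (`I_t = ker(ℓ|_{S_t})` has codimension one because
`ℓ|_{S_t} ≠ 0`). [cite: Kloosterman2025, Lemma 2.1] -/
theorem hilbert_annIdeal_top [Finite σ] (hℓ : ∀ p, ℓ (homogeneousComponent t p) = ℓ p) (hne : ℓ ≠ 0) :
    finrank K (homogeneousSubmodule σ K t) - finrank K (idealDegree (annIdeal ℓ) t) = 1 := by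
  haveI := finite_homogeneousSubmodule (K := K) (σ := σ) t
  -- `ℓ|_{S_t}` is a non-zero functional, its kernel is `I_t` viewed in `S_t`
  set ℓt : homogeneousSubmodule σ K t →ₗ[K] K := ℓ ∘ₗ (homogeneousSubmodule σ K t).subtype with hℓt
  have hker : LinearMap.ker ℓt = (idealDegree (annIdeal ℓ) t).comap (homogeneousSubmodule σ K t).subtype := by
    ext g
    simp only [hℓt, LinearMap.mem_ker, LinearMap.coe_comp, Function.comp_apply, Submodule.subtype_apply,
      Submodule.mem_comap, mem_idealDegree]
    rw [mem_annIdeal_iff_apply_eq_zero hℓ g.2]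
    exact ⟨fun h => ⟨h, g.2⟩, fun h => h.1⟩
  have hne' : ℓt ≠ 0 := by
    intro h0
    apply hne
    refine LinearMap.ext fun p => ?_
    have h1 : ℓt ⟨homogeneousComponent t p, homogeneousComponent_mem t p⟩ = 0 := by
      rw [h0, LinearMap.zero_apply]
    rw [LinearMap.zero_apply, ← hℓ p]
    simpa [hℓt] using h1
  have hrange : finrank K (LinearMap.range ℓt) = 1 := by
    rcases Ideal.eq_bot_or_top (LinearMap.range ℓt) with h0 | htop
    · exact absurd (LinearMap.range_eq_bot.mp h0) hne'
    · rw [htop, finrank_top, Module.finrank_self]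
  have h1 := LinearMap.finrank_range_add_finrank_ker ℓt
  rw [hker, (Submodule.comapSubtypeEquivOfLe (idealDegree_le_homogeneousSubmodule _ _)).finrank_eq,
    hrange] at h1
  omega

/-! ### Colon ideals by a form: `(I(ℓ) : P)` is the Gorenstein ideal of `ℓ_P = ℓ(· P)` -/

/-- For a form `P` of degree `e` with `e + s = t`, the functional `ℓ_P = ℓ(· P)` is concentrated in degree
`s = t − e`. [folklore; cf. [cite: Kloosterman2025, Construction 3.1]] -/
theorem comp_mulRight_homogeneousComponent (hℓ : ∀ p, ℓ (homogeneousComponent t p) = ℓ p)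
    {P : MvPolynomial σ K} {e s : ℕ} (hP : P.IsHomogeneous e) (hes : e + s = t) (p : MvPolynomial σ K) :
    (ℓ ∘ₗ LinearMap.mulRight K P) (homogeneousComponent s p) = (ℓ ∘ₗ LinearMap.mulRight K P) p := by
  simp only [LinearMap.coe_comp, Function.comp_apply, LinearMap.mulRight_apply]
  rw [mul_comm, mul_comm p, apply_mul_eq_apply_mul_homogeneousComponent hℓ hP hes p]

/-- Hence `(I(ℓ) : P)` — the annihilator ideal of `ℓ_P` (`annIdeal_comp_mulRight`) — has the Gorenstein
symmetry `h(a) = h(b)` for `a + b = t − e`. [folklore; cf. [cite: Kloosterman2025, Construction 3.1, Remark 3.2]] -/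
theorem hilbert_colon_symm [Finite σ] (hℓ : ∀ p, ℓ (homogeneousComponent t p) = ℓ p)
    {P : MvPolynomial σ K} {e s : ℕ} (hP : P.IsHomogeneous e) (hes : e + s = t) {a b : ℕ}
    (hab : a + b = s) :
    finrank K (homogeneousSubmodule σ K a) - finrank K (idealDegree ((annIdeal ℓ).colon {P}) a) =
      finrank K (homogeneousSubmodule σ K b) - finrank K (idealDegree ((annIdeal ℓ).colon {P}) b) := by
  rw [← annIdeal_comp_mulRight]
  exact hilbert_annIdeal_symm (comp_mulRight_homogeneousComponent hℓ hP hes) hab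

/-- … and socle degree `t − e` (`h(t − e) = 1`) as soon as `P ∉ I(ℓ)`; `(I(ℓ) : P) = S` when `P ∈ I(ℓ)`
(`annIdeal_comp_mulRight_eq_top_iff`). [folklore; cf. [cite: Kloosterman2025, Construction 3.1, Remark 3.2]] -/
theorem hilbert_colon_top [Finite σ] (hℓ : ∀ p, ℓ (homogeneousComponent t p) = ℓ p)
    {P : MvPolynomial σ K} {e s : ℕ} (hP : P.IsHomogeneous e) (hes : e + s = t) (hPI : P ∉ annIdeal ℓ) :
    finrank K (homogeneousSubmodule σ K s) - finrank K (idealDegree ((annIdeal ℓ).colon {P}) s) = 1 := by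
  rw [← annIdeal_comp_mulRight]
  refine hilbert_annIdeal_top (comp_mulRight_homogeneousComponent hℓ hP hes) fun h0 => hPI ?_
  rw [← annIdeal_comp_mulRight_eq_top_iff, annIdeal_eq_top_iff]
  exact h0

/-- … and vanishes above `t − e`: every form of degree `a > t − e` lies in `(I(ℓ) : P)`.
[folklore; cf. [cite: Kloosterman2025, Remark 3.2]] -/
theorem idealDegree_colon_eq_of_lt (hℓ : ∀ p, ℓ (homogeneousComponent t p) = ℓ p)
    {P : MvPolynomial σ K} {e s : ℕ} (hP : P.IsHomogeneous e) (hes : e + s = t) {a : ℕ} (ha : s < a) :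
    idealDegree ((annIdeal ℓ).colon {P}) a = homogeneousSubmodule σ K a := by
  rw [← annIdeal_comp_mulRight]
  exact idealDegree_annIdeal_eq_of_lt (comp_mulRight_homogeneousComponent hℓ hP hes) ha

end Graded

/-! ## Two functionals: Notation 2.4 made concrete, and Lemma 2.9 on `S` -/

section TwoFunctionals

variable {K : Type*} [Field K] {σ : Type*} {t : ℕ} {ℓ₁ ℓ₂ : MvPolynomial σ K →ₗ[K] K}

/-- `I(ℓ₁) ∩ I(ℓ₂)` kills both pairings: the common part of the two left kernels.
[cite: Kloosterman2025, Notation 2.4] -/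
theorem apply_mul_eq_zero_of_mem_inf {g : MvPolynomial σ K} (hg : g ∈ annIdeal ℓ₁ ⊓ annIdeal ℓ₂)
    (c : K) (h : MvPolynomial σ K) : ℓ₁ (g * h) + c * ℓ₂ (g * h) = 0 := by
  rw [hg.1 h, hg.2 h, mul_zero, add_zero]

/-- The pencil member `ℓ₁ + c ℓ₂` is again concentrated in degree `t`. [cite: Kloosterman2025, Lemma 2.9 (proof)] -/
theorem add_smul_homogeneousComponent (hℓ₁ : ∀ p, ℓ₁ (homogeneousComponent t p) = ℓ₁ p)
    (hℓ₂ : ∀ p, ℓ₂ (homogeneousComponent t p) = ℓ₂ p) (c : K) (p : MvPolynomial σ K) :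
    (ℓ₁ + c • ℓ₂) (homogeneousComponent t p) = (ℓ₁ + c • ℓ₂) p := by
  simp [hℓ₁ p, hℓ₂ p]

/-- **Lemma 2.9 on `S` (S-level form).** Let `ℓ₁, ℓ₂` be concentrated in degree `t`, `I_j = I(ℓ_j)`,
`a + b = t`, and suppose `(I₁)_b + (I₂)_b = S_b` (the printed hypothesis `h_{I₁+I₂}(t−α) = 0`, see
`idealDegree_sup_eq_top_of_hilbert_eq_zero`). If a form `g` of degree `a` satisfies
`ℓ₁(gh) + c·ℓ₂(gh) = 0` for all forms `h` of degree `b`, with `c ≠ 0`, then `g ∈ I₁ ∩ I₂` — i.e. the left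
kernel of `φ₁ + c φ₂` on `(S/I₁∩I₂)_a` is ZERO. Printed proof, followed verbatim: for `w ∈ ker_R φ₂ = (I₂)_b`
the hypothesis gives `φ₁(g,w) = 0`; also `φ₁(g,w) = 0` for `w ∈ (I₁)_b`; so `g ⊥ (I₁)_b + (I₂)_b = S_b` for
`φ₁`, whence `g ∈ I₁` by the perfect pairing; symmetrically (using `c ≠ 0`) `g ∈ I₂`.
[cite: Kloosterman2025, Lemma 2.9] -/
theorem mem_inf_annIdeal_of_forall_add_smul_eq_zero
    (hℓ₁ : ∀ p, ℓ₁ (homogeneousComponent t p) = ℓ₁ p) (hℓ₂ : ∀ p, ℓ₂ (homogeneousComponent t p) = ℓ₂ p)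
    {a b : ℕ} (hab : a + b = t)
    (hspan : idealDegree (annIdeal ℓ₁) b ⊔ idealDegree (annIdeal ℓ₂) b = homogeneousSubmodule σ K b)
    {c : K} (hc : c ≠ 0) {g : MvPolynomial σ K} (hg : g.IsHomogeneous a)
    (H : ∀ h : MvPolynomial σ K, h.IsHomogeneous b → ℓ₁ (g * h) + c * ℓ₂ (g * h) = 0) :
    g ∈ annIdeal ℓ₁ ⊓ annIdeal ℓ₂ := by
  -- `φ₁(g, w) = 0` for `w ∈ (I₁)_b` and for `w ∈ (I₂)_b`, hence for `w ∈ S_b`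
  have h1 : ∀ w : MvPolynomial σ K, w.IsHomogeneous b → ℓ₁ (g * w) = 0 := by
    intro w hw
    have hw' : w ∈ idealDegree (annIdeal ℓ₁) b ⊔ idealDegree (annIdeal ℓ₂) b := hspan ▸ hw
    obtain ⟨w₁, hw₁, w₂, hw₂, rfl⟩ := Submodule.mem_sup.mp hw'
    have e₁ : ℓ₁ (g * w₁) = 0 := by rw [mul_comm]; exact hw₁.1 g
    have e₂ : ℓ₂ (g * w₂) = 0 := by rw [mul_comm]; exact hw₂.1 g
    have e₃ : ℓ₁ (g * w₂) + c * ℓ₂ (g * w₂) = 0 := H w₂ hw₂.2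
    rw [e₂, mul_zero, add_zero] at e₃
    rw [mul_add, map_add, e₁, e₃, add_zero]
  -- symmetrically `φ₂(g, w) = 0` for `w ∈ S_b` (here `c ≠ 0` is used)
  have h2 : ∀ w : MvPolynomial σ K, w.IsHomogeneous b → ℓ₂ (g * w) = 0 := by
    intro w hw
    have e := H w hw
    rw [h1 w hw, zero_add] at e
    exact (mul_eq_zero.mp e).resolve_left hc
  exact ⟨mem_annIdeal_of_forall_isHomogeneous hℓ₁ hg hab h1,
    mem_annIdeal_of_forall_isHomogeneous hℓ₂ hg hab h2⟩

/-- **Lemma 2.9, kernel form**: under `(I₁)_b + (I₂)_b = S_b` (`a + b = t`, `c ≠ 0`) the left kernel of the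
pencil member `φ₁ + c φ₂ : S_a × S_b → K` is exactly `(I₁ ∩ I₂)_a` — zero on the quotient
`(S/I₁∩I₂)_a`, which is the printed "`ker_L(φ₁ + λφ₂) = 0`". [cite: Kloosterman2025, Lemma 2.9] -/
theorem ker_gradedMulForm_add_smul
    (hℓ₁ : ∀ p, ℓ₁ (homogeneousComponent t p) = ℓ₁ p) (hℓ₂ : ∀ p, ℓ₂ (homogeneousComponent t p) = ℓ₂ p)
    {a b : ℕ} (hab : a + b = t)
    (hspan : idealDegree (annIdeal ℓ₁) b ⊔ idealDegree (annIdeal ℓ₂) b = homogeneousSubmodule σ K b)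
    {c : K} (hc : c ≠ 0) :
    LinearMap.ker (gradedMulForm (ℓ₁ + c • ℓ₂) a b) =
      (idealDegree (annIdeal ℓ₁ ⊓ annIdeal ℓ₂) a).comap (homogeneousSubmodule σ K a).subtype := by
  ext g
  rw [mem_ker_iff_forall, Submodule.mem_comap, Submodule.subtype_apply, mem_idealDegree]
  constructor
  · intro H
    refine ⟨mem_inf_annIdeal_of_forall_add_smul_eq_zero hℓ₁ hℓ₂ hab hspan hc g.2 fun h hh => ?_, g.2⟩
    simpa using H ⟨h, hh⟩
  · rintro ⟨hg, -⟩ h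
    simpa using apply_mul_eq_zero_of_mem_inf hg c (h : MvPolynomial σ K)

/-- The printed hypothesis in Hilbert-function form: `h_{I₁+I₂}(b) = 0`, i.e. `(I₁ + I₂)_b = S_b`, gives
`(I₁)_b + (I₂)_b = S_b` (degreewise sum of homogeneous ideals, tree lemma `idealDegree_sup`).
[cite: Kloosterman2025, Lemma 2.9] -/
theorem idealDegree_sup_idealDegree_eq_of_sup
    (hℓ₁ : ∀ p, ℓ₁ (homogeneousComponent t p) = ℓ₁ p) (hℓ₂ : ∀ p, ℓ₂ (homogeneousComponent t p) = ℓ₂ p)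
    {b : ℕ} (h : idealDegree (annIdeal ℓ₁ ⊔ annIdeal ℓ₂) b = homogeneousSubmodule σ K b) :
    idealDegree (annIdeal ℓ₁) b ⊔ idealDegree (annIdeal ℓ₂) b = homogeneousSubmodule σ K b := by
  rw [← idealDegree_sup (isHomogeneous_annIdeal hℓ₁) (isHomogeneous_annIdeal hℓ₂), h]

/-- … and `h_{I₁+I₂}(b) = 0` literally (as the vanishing of `dim S_b − dim (I₁+I₂)_b`, `σ` finite) gives it
too. [cite: Kloosterman2025, Lemma 2.9] -/
theorem idealDegree_sup_eq_top_of_hilbert_eq_zero [Finite σ]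
    (hℓ₁ : ∀ p, ℓ₁ (homogeneousComponent t p) = ℓ₁ p) (hℓ₂ : ∀ p, ℓ₂ (homogeneousComponent t p) = ℓ₂ p)
    {b : ℕ} (h : finrank K (homogeneousSubmodule σ K b) -
      finrank K (idealDegree (annIdeal ℓ₁ ⊔ annIdeal ℓ₂) b) = 0) :
    idealDegree (annIdeal ℓ₁) b ⊔ idealDegree (annIdeal ℓ₂) b = homogeneousSubmodule σ K b := by
  haveI := finite_homogeneousSubmodule (K := K) (σ := σ) b
  apply idealDegree_sup_idealDegree_eq_of_sup hℓ₁ hℓ₂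
  have hle := idealDegree_le_homogeneousSubmodule (annIdeal ℓ₁ ⊔ annIdeal ℓ₂) b
  have hfin := finrank_idealDegree_le (annIdeal ℓ₁ ⊔ annIdeal ℓ₂) b
  exact Submodule.eq_of_le_of_finrank_eq hle (by omega)

/-- **Lemma 2.9 as printed** (S-level): "If `h_{I₁+I₂}(t−α) = 0` then for all `λ ∈ ℂ*` we have
`ker_L(φ₁ + λφ₂) = 0`" — with `I_j = I(ℓ_j)` the Artinian Gorenstein ideals of two functionals of the
same socle degree `t`, the left kernel of `φ₁ + λ φ₂` on `S_α` is `(I₁ ∩ I₂)_α`, i.e. zero on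
`(S/I₁∩I₂)_α`. [cite: Kloosterman2025, Lemma 2.9] -/
theorem ker_gradedMulForm_add_smul_of_hilbert_eq_zero [Finite σ]
    (hℓ₁ : ∀ p, ℓ₁ (homogeneousComponent t p) = ℓ₁ p) (hℓ₂ : ∀ p, ℓ₂ (homogeneousComponent t p) = ℓ₂ p)
    {α : ℕ} (hα : α ≤ t)
    (h : finrank K (homogeneousSubmodule σ K (t - α)) -
      finrank K (idealDegree (annIdeal ℓ₁ ⊔ annIdeal ℓ₂) (t - α)) = 0)
    {c : K} (hc : c ≠ 0) :
    LinearMap.ker (gradedMulForm (ℓ₁ + c • ℓ₂) α (t - α)) =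
      (idealDegree (annIdeal ℓ₁ ⊓ annIdeal ℓ₂) α).comap (homogeneousSubmodule σ K α).subtype :=
  ker_gradedMulForm_add_smul hℓ₁ hℓ₂ (by omega) (idealDegree_sup_eq_top_of_hilbert_eq_zero hℓ₁ hℓ₂ h) hc

end TwoFunctionals

/-! ## Lemma 2.10: left kernels of the restricted pairings `μ_α` propagate upward in degree -/

section Lemma210

variable {K : Type*} [Field K] {σ : Type*} {t : ℕ} {ℓ : MvPolynomial σ K →ₗ[K] K}

/-- **The socle of `S/I(ℓ)` is concentrated in degree `t`**: a form `f` of degree `a < t` with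
`x_i f ∈ I(ℓ)` for every variable `x_i` lies in `I(ℓ)` (every form of degree `t − a ≥ 1` lies in the ideal
`(x_i : i)`, so `f · S_{t−a} ⊆ I(ℓ)` and the perfect pairing applies) — the step "since `α < t` we can find a
linear form `l` such that `l f` is nonzero" of the printed proof of Lemma 2.10.
[cite: Kloosterman2025, Lemma 2.10 (proof)] -/
theorem mem_annIdeal_of_forall_X_mul_mem (hℓ : ∀ p, ℓ (homogeneousComponent t p) = ℓ p)
    {f : MvPolynomial σ K} {a : ℕ} (hf : f.IsHomogeneous a) (ha : a < t)
    (H : ∀ i : σ, X i * f ∈ annIdeal ℓ) : f ∈ annIdeal ℓ := by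
  refine mem_annIdeal_of_forall_isHomogeneous hℓ hf (Nat.add_sub_cancel' ha.le) fun h hh => ?_
  -- `(x_i : i) ≤ (I(ℓ) : f)`
  have hcolon : Ideal.span (Set.range (X : σ → MvPolynomial σ K)) ≤ (annIdeal ℓ).colon {f} := by
    refine Ideal.span_le.mpr ?_
    rintro _ ⟨i, rfl⟩
    rw [SetLike.mem_coe, Submodule.mem_colon_singleton, smul_eq_mul]
    exact H i
  -- a form of positive degree lies in `(x_i : i)`
  have hmem : h ∈ Ideal.span (Set.range (X : σ → MvPolynomial σ K)) := by
    rw [← Set.image_univ, mem_ideal_span_X_image]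
    intro m hm
    have hdeg : m.degree = t - a := by
      rw [Finsupp.degree_eq_weight_one]
      exact hh (mem_support_iff.mp hm)
    by_contra hnone
    push Not at hnone
    have hm0 : m = 0 := Finsupp.ext fun i => hnone i (Set.mem_univ i)
    rw [hm0, map_zero] at hdeg
    omega
  have hfh : h * f ∈ annIdeal ℓ := by
    have := hcolon hmem
    rwa [Submodule.mem_colon_singleton, smul_eq_mul] at this
  rw [mul_comm]
  exact apply_eq_zero_of_mem_annIdeal hfh

/-- **Lemma 2.10 (S-level).** "Let `I, J ⊂ S` be homogeneous ideals such that `S/I` is Artinian Gorenstein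
[of socle degree `t`]. Let `0 ≤ α ≤ t − 1`. Suppose the left kernel of
`μ_α : ((J+I)/I)_α × ((J+I)/I)_{t−α} → (S/I)_t` is nonzero. Then the left kernel of
`μ_{α+1} : ((J+I)/I)_{α+1} × ((J+I)/I)_{t−α−1} → (S/I)_t` is also nonzero." Here `I = I(ℓ)` and a non-zero
element of `ker_L μ_α` is a form `f ∈ J + I` of degree `α`, `f ∉ I`, with `ℓ(f g) = 0` for every form
`g ∈ J + I` of degree `t − α`; the witness in degree `α + 1` is `x_i f` for a variable with `x_i f ∉ I`
(`mem_annIdeal_of_forall_X_mul_mem`), and `μ_{α+1}(x_i f, g) = μ_α(f, x_i g) = 0` (printed proof, followed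
verbatim; no hypothesis on `J` is needed for this implication). [cite: Kloosterman2025, Lemma 2.10] -/
theorem exists_mem_leftKernel_succ (hℓ : ∀ p, ℓ (homogeneousComponent t p) = ℓ p)
    {J : Ideal (MvPolynomial σ K)} {α : ℕ} (hα : α < t) {f : MvPolynomial σ K}
    (hfJ : f ∈ J ⊔ annIdeal ℓ) (hf : f.IsHomogeneous α) (hfI : f ∉ annIdeal ℓ)
    (hker : ∀ g ∈ J ⊔ annIdeal ℓ, g.IsHomogeneous (t - α) → ℓ (f * g) = 0) :
    ∃ f' ∈ J ⊔ annIdeal ℓ, f'.IsHomogeneous (α + 1) ∧ f' ∉ annIdeal ℓ ∧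
      ∀ g ∈ J ⊔ annIdeal ℓ, g.IsHomogeneous (t - α - 1) → ℓ (f' * g) = 0 := by
  -- a variable `x_i` with `x_i f ∉ I` ("a linear form `l` such that `l f` is nonzero")
  obtain ⟨i, hi⟩ : ∃ i : σ, X i * f ∉ annIdeal ℓ := by
    by_contra hall
    push Not at hall
    exact hfI (mem_annIdeal_of_forall_X_mul_mem hℓ hf hα hall)
  refine ⟨X i * f, Ideal.mul_mem_left _ _ hfJ, ?_, hi, fun g hg hgdeg => ?_⟩
  · rw [add_comm]
    exact (isHomogeneous_X K i).mul hf
  · -- `μ_{α+1}(x_i f, g) = μ_α(f, x_i g) = 0`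
    have hXg : (X i * g).IsHomogeneous (t - α) := by
      have := (isHomogeneous_X K i).mul hgdeg
      rwa [show 1 + (t - α - 1) = t - α by omega] at this
    rw [show X i * f * g = f * (X i * g) by ring]
    exact hker _ (Ideal.mul_mem_left _ _ hg) hXg

end Lemma210

/-! ## The excess bound `e(λ) ≤ h_{I₁+I₂}(t−α)` for the Gorenstein ideals of two functionals -/

section ExcessBound

variable {K : Type*} [Field K] {σ : Type*} {t : ℕ} {ℓ₁ ℓ₂ : MvPolynomial σ K →ₗ[K] K}

/-- The graded pieces of the pairing are linear in the functional: `φ_{ℓ₁ + c ℓ₂} = φ₁ + c φ₂`.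
[cite: Kloosterman2025, Notation 2.4] -/
theorem gradedMulForm_add_smul (ℓ₁ ℓ₂ : MvPolynomial σ K →ₗ[K] K) (c : K) (a b : ℕ) :
    gradedMulForm (ℓ₁ + c • ℓ₂) a b = gradedMulForm ℓ₁ a b + c • gradedMulForm ℓ₂ a b := by
  ext g h
  simp [gradedMulForm_apply]

/-- For subspaces of `S_b`, pulling back to `S_b` commutes with `⊔`. [folklore; cf. [cite: Kloosterman2025, Lemma 2.9 (proof)]] -/
private theorem comap_subtype_sup_of_le {M : Type*} [AddCommGroup M] [Module K M] {P X Y : Submodule K M}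
    (hX : X ≤ P) (hY : Y ≤ P) :
    X.comap P.subtype ⊔ Y.comap P.subtype = (X ⊔ Y).comap P.subtype := by
  apply le_antisymm
  · exact sup_le (Submodule.comap_mono le_sup_left) (Submodule.comap_mono le_sup_right)
  · intro v hv
    rw [Submodule.mem_comap, Submodule.subtype_apply] at hv
    obtain ⟨x, hx, y, hy, hxy⟩ := Submodule.mem_sup.mp hv
    have hv' : v = ⟨x, hX hx⟩ + ⟨y, hY hy⟩ := Subtype.ext (by simpa using hxy.symm)
    rw [hv']
    exact Submodule.add_mem_sup (by simpa using hx) (by simpa using hy)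

/-- **The excess bound, Hilbert-function data on both sides.** For two functionals `ℓ₁, ℓ₂` concentrated in
degree `t`, `I_j = I(ℓ_j)`, `a + b = t` and `c ≠ 0`:
`dim ker_L(φ₁ + c φ₂)|_{S_a} + dim (I₁+I₂)_b ≤ dim (I₁∩I₂)_a + dim S_b`, i.e. the EXCESS
`e(c) := dim ker_L(φ₁ + cφ₂) − dim (I₁∩I₂)_a` (the left kernel on `(S/I₁∩I₂)_a`) is at most
`h_{I₁+I₂}(b) = dim S_b − dim (I₁+I₂)_b` — the tree's abstract `finrank_leftKernel_add_smul_add_le_finrank_inf_add`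
(printed proof of Lemma 2.9 with Lemma 3.12) with its kernels identified: `ker_R φ_j = (I_j)_b`
(`ker_gradedMulForm_flip`), `ker_L φ₁ ∩ ker_L φ₂ = (I₁ ∩ I₂)_a` (`ker_gradedMulForm`), `(I₁)_b + (I₂)_b = (I₁+I₂)_b`
(`idealDegree_sup`). With `I_j = (J^F : P_j)` the Artinian Gorenstein ideals of two cycle classes and
`(a, b) = (d, kd−2k−2)` this is the census bound "`e(λ) ≤ H = h_{I_Z+I_W}(kd−2k−2)` for every `λ ∈ ℚ*`".
[cite: Kloosterman2025, Lemma 2.9 (proof), Lemma 3.12] -/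
theorem finrank_ker_gradedMulForm_add_smul_add_le [Finite σ]
    (hℓ₁ : ∀ p, ℓ₁ (homogeneousComponent t p) = ℓ₁ p) (hℓ₂ : ∀ p, ℓ₂ (homogeneousComponent t p) = ℓ₂ p)
    {a b : ℕ} (hab : a + b = t) {c : K} (hc : c ≠ 0) :
    finrank K (LinearMap.ker (gradedMulForm (ℓ₁ + c • ℓ₂) a b)) +
        finrank K (idealDegree (annIdeal ℓ₁ ⊔ annIdeal ℓ₂) b) ≤
      finrank K (idealDegree (annIdeal ℓ₁ ⊓ annIdeal ℓ₂) a) + finrank K (homogeneousSubmodule σ K b) := by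
  haveI := finite_homogeneousSubmodule (K := K) (σ := σ) a
  haveI := finite_homogeneousSubmodule (K := K) (σ := σ) b
  have h := finrank_leftKernel_add_smul_add_le_finrank_inf_add (gradedMulForm ℓ₁ a b) (gradedMulForm ℓ₂ a b) hc
  -- identify the four subspaces
  have e1 : LinearMap.ker (gradedMulForm ℓ₁ a b + c • gradedMulForm ℓ₂ a b) =
      LinearMap.ker (gradedMulForm (ℓ₁ + c • ℓ₂) a b) := by rw [gradedMulForm_add_smul]
  have e2 : LinearMap.ker (gradedMulForm ℓ₁ a b).flip ⊔ LinearMap.ker (gradedMulForm ℓ₂ a b).flip =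
      (idealDegree (annIdeal ℓ₁ ⊔ annIdeal ℓ₂) b).comap (homogeneousSubmodule σ K b).subtype := by
    rw [ker_gradedMulForm_flip hℓ₁ hab, ker_gradedMulForm_flip hℓ₂ hab,
      comap_subtype_sup_of_le (idealDegree_le_homogeneousSubmodule _ _) (idealDegree_le_homogeneousSubmodule _ _),
      ← idealDegree_sup (isHomogeneous_annIdeal hℓ₁) (isHomogeneous_annIdeal hℓ₂)]
  have e3 : LinearMap.ker (gradedMulForm ℓ₁ a b) ⊓ LinearMap.ker (gradedMulForm ℓ₂ a b) =
      (idealDegree (annIdeal ℓ₁ ⊓ annIdeal ℓ₂) a).comap (homogeneousSubmodule σ K a).subtype := by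
    rw [ker_gradedMulForm hℓ₁ hab, ker_gradedMulForm hℓ₂ hab, ← Submodule.comap_inf, ← idealDegree_inf]
  rw [e1, e2, e3, (Submodule.comapSubtypeEquivOfLe (idealDegree_le_homogeneousSubmodule _ _)).finrank_eq,
    (Submodule.comapSubtypeEquivOfLe (idealDegree_le_homogeneousSubmodule _ _)).finrank_eq] at h
  exact h

/-- `(I₁ ∩ I₂)_a` always lies in the left kernel of `φ₁ + c φ₂` (so the excess is a genuine difference).
[cite: Kloosterman2025, Notation 2.4] -/
theorem comap_idealDegree_inf_le_ker_gradedMulForm_add_smul (c : K) (a b : ℕ) :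
    (idealDegree (annIdeal ℓ₁ ⊓ annIdeal ℓ₂) a).comap (homogeneousSubmodule σ K a).subtype ≤
      LinearMap.ker (gradedMulForm (ℓ₁ + c • ℓ₂) a b) := by
  intro g hg
  rw [Submodule.mem_comap, Submodule.subtype_apply, mem_idealDegree] at hg
  rw [mem_ker_iff_forall]
  intro h
  simpa using apply_mul_eq_zero_of_mem_inf hg.1 c (h : MvPolynomial σ K)

/-- **`e(c) ≤ h_{I₁+I₂}(b)`** in Hilbert-function form: for `a + b = t`, `c ≠ 0`,
`dim ker_L(φ₁ + cφ₂)|_{S_a} − dim (I₁ ∩ I₂)_a ≤ dim S_b − dim (I₁ + I₂)_b`.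
[cite: Kloosterman2025, Lemma 2.9 (proof), Lemma 3.12] -/
theorem excess_le_hilbert_sup [Finite σ]
    (hℓ₁ : ∀ p, ℓ₁ (homogeneousComponent t p) = ℓ₁ p) (hℓ₂ : ∀ p, ℓ₂ (homogeneousComponent t p) = ℓ₂ p)
    {a b : ℕ} (hab : a + b = t) {c : K} (hc : c ≠ 0) :
    finrank K (LinearMap.ker (gradedMulForm (ℓ₁ + c • ℓ₂) a b)) -
        finrank K (idealDegree (annIdeal ℓ₁ ⊓ annIdeal ℓ₂) a) ≤
      finrank K (homogeneousSubmodule σ K b) - finrank K (idealDegree (annIdeal ℓ₁ ⊔ annIdeal ℓ₂) b) := by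
  have h := finrank_ker_gradedMulForm_add_smul_add_le hℓ₁ hℓ₂ hab hc
  have h1 := finrank_idealDegree_le (annIdeal ℓ₁ ⊔ annIdeal ℓ₂) b
  omega

end ExcessBound

end Literature.AlgebraicGeometry.Kloosterman2025

end
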